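import Mathlib
import Summits.NavierStokesRegularity.NavierStokesRegularity.Theorems.EulerZoomLiouvillePowerGaugeEulerLiouvilleNeedleAxisymAnyAxis
import HarnessLib.Audit

/-!
# Crux E `EulerZoomLiouville.PowerGaugeEulerLiouville` — the axisymmetric swirl-free `C²` needle stratum about any axis:
# PAST-EXACT MEMBERS (ROUND-37 (S37), shifted twin ∘ class isometry transport)

Route №10 `EulerZoomLiouville` (NavierStokesRegularity), crux E = stmt-NavierStokesRegularity-19832.  Sequel of
`…NeedleAxisymAnyAxis`: the conjugation `(u, p, H) ↦ (R u(s, R⁻¹x), p(s, R⁻¹x), R H R⁻¹)` maps a member exactly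
self-similar about `(T, x₀)` for `τ < T₁` with profile `V` to a member exactly self-similar about `(T, R x₀)` with profile
`y ↦ R V(R⁻¹ y)` (`selfSimilarCollapse_conj_shifted`), so `NeedleRace.selfSimilar_ae_eq_zero_of_axisymNoSwirlC2_past` applies
about ANY axis:

* **`selfSimilar_ae_eq_zero_of_axisymNoSwirlC2_past_conj`** — crux hypotheses verbatim (`0 < ρ ≤ ½`) + exact self-similarity
  about `(T, x₀)` for `τ < T₁` (`T₁ ≤ 0`, `T₁ ≤ T`) + `V ∈ C²` + for some linear isometry `R` the conjugated profile is
  axisymmetric and swirl-free ⇒ `u = 0` a.e. on the slab (binder shape for the lead skeleton's `IsPastSelfSimilarClassical`).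

NOT NS, not E; 19832 OPEN.  References: Constantin–Ignatova–Vicol arXiv:2602.17570 §3.4–§3.5 [ConstantinIgnatovaVicol2026Putative];
Majda–Bertozzi 2002 §1.2 Prop. 1.1 (iii) [MajdaBertozziCUP2002].
-/

noncomputable section

-- the summit and its single problem share the name `NavierStokesRegularity` (D-0017 nested layout)
set_option linter.dupNamespace false

open Set Filter Topology Metric Function MeasureTheory InnerProductSpace
open scoped RealInnerProductSpace NNReal ENNReal

namespace Summit.NavierStokesRegularity.NavierStokesRegularity.Theorems.PowerGaugeEulerLiouville.NeedleRace

open Literature.Analysis Literature.Analysis.FluidPDE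
open Summit.NavierStokesRegularity.NavierStokesRegularity.Theorems.PowerGaugeEulerLiouville
open Summit.NavierStokesRegularity.NavierStokesRegularity.Theorems.PowerGaugeEulerLiouville.ClassIsometry
open Summit.NavierStokesRegularity.NavierStokesRegularity.Theorems.PowerGaugeEulerLiouville.PressureSlaving

/-- The shifted ansatz commutes with linear isometries, the centre moving to `R x₀`:
`R (selfSimilarCollapse γ T V τ (R⁻¹ x − x₀)) = selfSimilarCollapse γ T (R ∘ V ∘ R⁻¹) τ (x − R x₀)`. [folklore] -/
theorem selfSimilarCollapse_conj_shifted (R : EuclideanSpace ℝ (Fin 3) ≃ₗᵢ[ℝ] EuclideanSpace ℝ (Fin 3)) (γ T τ : ℝ)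
    (V : EuclideanSpace ℝ (Fin 3) → EuclideanSpace ℝ (Fin 3)) (x₀ x : EuclideanSpace ℝ (Fin 3)) :
    R (selfSimilarCollapse γ T V τ (R.symm x - x₀)) =
      selfSimilarCollapse γ T (fun y => R (V (R.symm y))) τ (x - R x₀) := by
  simp only [selfSimilarCollapse_apply, map_smul, map_sub, LinearIsometryEquiv.symm_apply_apply]

/-- The shifted pressure ansatz commutes with linear isometries. [folklore] -/
theorem selfSimilarCollapsePressure_conj_shifted (R : EuclideanSpace ℝ (Fin 3) ≃ₗᵢ[ℝ] EuclideanSpace ℝ (Fin 3))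
    (γ T τ : ℝ) (P : EuclideanSpace ℝ (Fin 3) → ℝ) (x₀ x : EuclideanSpace ℝ (Fin 3)) :
    selfSimilarCollapsePressure γ T P τ (R.symm x - x₀) =
      selfSimilarCollapsePressure γ T (fun y => P (R.symm y)) τ (x - R x₀) := by
  simp only [selfSimilarCollapsePressure_apply, map_smul, map_sub, LinearIsometryEquiv.symm_apply_apply]

/-- **PAST-EXACT MEMBERS WITH A `C²` PROFILE AXISYMMETRIC AND SWIRL-FREE ABOUT ANY AXIS ARE TRIVIAL.**  Crux hypotheses
verbatim (`0 < ρ ≤ ½`) + exact self-similarity about `(T, x₀)` for `τ < T₁` (`T₁ ≤ 0`, `T₁ ≤ T`) + `V ∈ C²` + for some linear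
isometry `R` of `ℝ³`, `y ↦ R V(R⁻¹ y)` is `IsAxisymmetric` and `HasNoSwirl` ⇒ `u = 0` a.e. on `(−∞,0) × ℝ³`.
[cite: ConstantinIgnatovaVicol2026Putative, §3.4.1 eq. (3.21)-(3.22), §3.5] -/
theorem selfSimilar_ae_eq_zero_of_axisymNoSwirlC2_past_conj {ρ T T₁ : ℝ} (hρ : 0 < ρ) (hρ1 : ρ ≤ 1 / 2)
    (hT₁ : T₁ ≤ 0) (hTT₁ : T₁ ≤ T) (x₀ : EuclideanSpace ℝ (Fin 3))
    {u : ℝ → EuclideanSpace ℝ (Fin 3) → EuclideanSpace ℝ (Fin 3)} {p : ℝ → EuclideanSpace ℝ (Fin 3) → ℝ}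
    {H : ℝ → EuclideanSpace ℝ (Fin 3) → EuclideanSpace ℝ (Fin 3) →L[ℝ] EuclideanSpace ℝ (Fin 3)} {c : ℝ≥0}
    (hsw : IsSuitableWeakSolutionOn (slab (EuclideanSpace ℝ (Fin 3)) (Iio 0) isOpen_Iio) 0 0 u p)
    (hH : HasWeakSpatialGradientOn (slab (EuclideanSpace ℝ (Fin 3)) (Iio 0) isOpen_Iio) u H)
    (hgauge : ∀ a : ℝ, 0 < a →
      ENNReal.ofReal (a ^ (2 * ρ)) * cknA a (0 : ℝ × EuclideanSpace ℝ (Fin 3)) u +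
          ENNReal.ofReal (a ^ ρ) * cknE a (0 : ℝ × EuclideanSpace ℝ (Fin 3)) H +
        ENNReal.ofReal (a ^ (2 * ρ)) * cknD a (0 : ℝ × EuclideanSpace ℝ (Fin 3)) p ≤ (c : ℝ≥0∞))
    {V : EuclideanSpace ℝ (Fin 3) → EuclideanSpace ℝ (Fin 3)} {P : EuclideanSpace ℝ (Fin 3) → ℝ}
    (hu : ∀ τ : ℝ, τ < T₁ → u τ = fun x => selfSimilarCollapse (1 / (2 + ρ)) T V τ (x - x₀))
    (hp : ∀ τ : ℝ, τ < T₁ → p τ = fun x => selfSimilarCollapsePressure (1 / (2 + ρ)) T P τ (x - x₀))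
    (hV : ContDiff ℝ 2 V) (R : EuclideanSpace ℝ (Fin 3) ≃ₗᵢ[ℝ] EuclideanSpace ℝ (Fin 3))
    (hax : IsAxisymmetric (fun y => R (V (R.symm y)))) (hns : HasNoSwirl (fun y => R (V (R.symm y)))) :
    uncurry u =ᵐ[volume.restrict (Iio (0 : ℝ) ×ˢ (univ : Set (EuclideanSpace ℝ (Fin 3))))] 0 := by
  -- adapted from `selfSimilar_ae_eq_zero_of_axisymNoSwirlC2_conj` (…NeedleAxisymAnyAxis)
  have hsw' := isSuitableWeakSolutionOn_conj_isometry isOpen_Iio hsw R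
  have hf0 : (fun (s : ℝ) (x : EuclideanSpace ℝ (Fin 3)) =>
      R ((0 : ℝ → EuclideanSpace ℝ (Fin 3) → EuclideanSpace ℝ (Fin 3)) s (R.symm x))) = 0 := by
    funext s x
    simp
  rw [hf0] at hsw'
  have hH' := hasWeakSpatialGradientOn_conj_isometry isOpen_Iio hH R
  have hgauge' := gauge_conj_isometry R hgauge
  have hu' : ∀ τ : ℝ, τ < T₁ → (fun s x => R (u s (R.symm x))) τ =
      fun x => selfSimilarCollapse (1 / (2 + ρ)) T (fun y => R (V (R.symm y))) τ (x - R x₀) := by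
    intro τ hτ
    funext x
    simp only [hu τ hτ, selfSimilarCollapse_conj_shifted]
  have hp' : ∀ τ : ℝ, τ < T₁ → (fun s x => p s (R.symm x)) τ =
      fun x => selfSimilarCollapsePressure (1 / (2 + ρ)) T (fun y => P (R.symm y)) τ (x - R x₀) := by
    intro τ hτ
    funext x
    simp only [hp τ hτ, selfSimilarCollapsePressure_conj_shifted]
  have hV' : ContDiff ℝ 2 (fun y => R (V (R.symm y))) :=
    R.toContinuousLinearEquiv.contDiff.comp (hV.comp R.symm.toContinuousLinearEquiv.contDiff)
  have h' := selfSimilar_ae_eq_zero_of_axisymNoSwirlC2_past hρ hρ1 hT₁ hTT₁ (R x₀) hsw' hH' hgauge' hu' hp' hV'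
    hax hns
  -- pull the vanishing back along `(s, x) ↦ (s, R x)`
  set Ψ : ℝ × EuclideanSpace ℝ (Fin 3) → ℝ × EuclideanSpace ℝ (Fin 3) := fun z => (z.1, R z.2) with hΨ
  have hΨmp : MeasurePreserving Ψ
      (volume.restrict (Iio (0 : ℝ) ×ˢ (univ : Set (EuclideanSpace ℝ (Fin 3)))))
      (volume.restrict (Iio (0 : ℝ) ×ˢ (univ : Set (EuclideanSpace ℝ (Fin 3))))) := by
    have h1 := (measurePreserving_prod_isometry R).restrict_preimage_emb (measurableEmbedding_prod_isometry R)
      (Iio (0 : ℝ) ×ˢ (univ : Set (EuclideanSpace ℝ (Fin 3))))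
    rwa [preimage_prod_isometry_slab] at h1
  have h2 : ∀ᵐ z ∂(volume.restrict (Iio (0 : ℝ) ×ˢ (univ : Set (EuclideanSpace ℝ (Fin 3))))),
      uncurry (fun s x => R (u s (R.symm x))) (Ψ z) = (0 : ℝ × EuclideanSpace ℝ (Fin 3) → EuclideanSpace ℝ (Fin 3)) (Ψ z) :=
    hΨmp.quasiMeasurePreserving.tendsto_ae.eventually h'
  filter_upwards [h2] with z hz
  have hz' : R (u z.1 z.2) = 0 := by simpa [hΨ, uncurry] using hz
  show u z.1 z.2 = 0
  simpa using hz'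

end Summit.NavierStokesRegularity.NavierStokesRegularity.Theorems.PowerGaugeEulerLiouville.NeedleRace

end
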